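import Mathlib.NumberTheory.ArithmeticFunction.Moebius
import Mathlib.NumberTheory.ArithmeticFunction.Misc
import Mathlib.NumberTheory.ArithmeticFunction.Zeta
import Mathlib.NumberTheory.EulerProduct.Basic
import Mathlib.NumberTheory.LSeries.RiemannZeta
import Mathlib.NumberTheory.ZetaValues
import Mathlib.Analysis.PSeries
import Literature.NumberTheory.LFunctions.NicolasOmega
import Literature.NumberTheory.LFunctions.RobinNumerical
import HarnessLib

/-!
# The LCM-power analogue of Robin's criterion (Fan–Kobayashi–Molnar 2026): the `¬RH` half

Topic: `Literature/NumberTheory/LFunctions`. Companion of `RobinCriterion.lean` (`robinInequality`),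
`LagariasCriterion.lean` (the named fact `Robin1984_sigma_oscillation`, Robin 1984 §4 Prop. 1) and
`NicolasOmega.lean` (its discharge `Robin1984_sigma_oscillation_holds`).

## Contents

Fan, Kobayashi and Molnar (Ramanujan J. 70 (2026); arXiv:2511.02106) study, for real `κ`, the
`κ`-th *LCM-power* of the sum-of-divisors function `σ^[κ](n) := ∑_{d ∣ n} μ(n/d) σ(d)^κ`
(their Definition 2; for `κ = k ∈ ℕ` it equals `∑_{[d₁,…,d_k] = n} d₁ ⋯ d_k` by Lehmer's
identity, Definition 1) and prove the **`κ`-Robin criterion** (Theorem 1.3): for real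
`κ > 3/2`, RH holds iff `σ^[κ](n) < (e^γ n log log n)^κ / ζ(κ)` for all sufficiently large `n`
(for `κ ≥ 2`: for all `n > 2162160`). This file types

* `sigmaRpow κ` (`n ↦ σ(n)^κ`) and `sigmaLcmPow κ = μ * sigmaRpow κ` (Definition 2), with the
  unfolding `sigmaLcmPow_apply`, multiplicativity, Möbius inversion, and the prime-power
  values `σ^[κ](p^a) = σ(p^a)^κ − σ(p^{a-1})^κ` (§3);
* `zetaRealSum κ = ∑' m, m^{-κ}` (the real number `ζ(κ)`, `κ > 1`; `= riemannZeta κ` in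
  `ofReal_zetaRealSum`; `zetaRealSum 2 = π²/6`);
* the pointwise inequality behind Lemma 17 ("counterexamples accrue as `κ` shrinks":
  `κ ↦ (ζ(κ) σ^[κ](n))^{1/κ}` decreases to `σ(n)`), in the form consumed by Theorem 5.2:
  **`σ(n)^κ ≤ ζ(κ) · σ^[κ](n)` for every `n` and real `κ > 1`**, proved prime power by
  prime power from `σ(p^a) = p σ(p^{a-1}) + 1` (`RobinCheck.sigma_prime_pow_succ`) and the bound
  `∏_{p ∣ n}(1 − p^{−κ})⁻¹ ≤ ζ(κ)` (Mathlib's `EulerProduct` over factored numbers) — a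
  deviation from the printed route (Lemma 18 + the limit `κ → ∞`), same conclusion;
* **Theorem 5.2** (`FanKobayashiMolnar2026_thm52`): if RH fails there are `b ∈ (0, 1/2)` and
  `c > 0`, independent of `κ`, such that for every real `κ > 1`,
  `σ^[κ](n) > (e^γ n log log n)^κ ζ(κ)⁻¹ (1 + c/(log n)^b)^κ` for infinitely many `n` — from
  the PROVED `Robin1984_sigma_oscillation_holds` (the paper's Theorem 5.1 = Robin 1984 §4
  Prop. 1, here in Lagarias's form: some `b ∈ (0, 1/2)` rather than every `b ∈ (1 − B, 1/2)`);
* the **implication (2) ⇒ (1) of Theorem 1.3 for every real `κ > 1`**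
  (`FanKobayashiMolnar2026_thm13_rh_of_eventually`; threshold form `…_rh_of_forall_gt`, the
  paper's (2′) being `n₀ = 2162160`), and the nesting `κ`-Robin(n) ⇒ Robin(n)
  (`robinInequality_of_sigmaLcmPow_lt`).

## Not here

The RH ⇒ (2) half (Theorem 6.1, `κ > 3/2`, via `κ`-colossally abundant numbers, §4; Theorem 6.2,
the effective `κ = 2` threshold `2162160` via Nicolas's bound), the `κ`-Lagarias criterion (§7),
Lehmer's identity (Def. 1 = Def. 2), the 79 exceptions below `2162160` (Remark 8) and the
verified range `(2162160, 10^(10^12.1408))`.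

## Sources

* S. Fan, M. Kobayashi, G. Molnar, *A family of analogues to the Robin criterion*, Ramanujan J.
  70 (2026), doi 10.1007/s11139-026-01408-3 = arXiv:2511.02106: Def. 2, Lemma 17, Thm. 5.2,
  Thm. 1.3. [FanKobayashiMolnar2026]
* G. Robin, J. Math. Pures Appl. 63 (1984), §4 Prop. 1 (via Lagarias 2002, Prop. 3.2);
  Apostol 1976 Thms. 11.6–11.7, 12.17; Titchmarsh (1.1.1). [Robin1984] [Lagarias2002]
-/

noncomputable section

open Real Filter Finset
open scoped ArithmeticFunction.sigma ArithmeticFunction.Moebius ArithmeticFunction.zeta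

namespace Literature.NumberTheory.LFunctions

/-! ### `σ(n)^κ` and the LCM-power `σ^[κ]` (Definition 2) -/

/-- The real arithmetic function `n ↦ σ(n)^κ` (`σ = ArithmeticFunction.sigma 1`), value `0` at
`n = 0` as `ArithmeticFunction` requires. Auxiliary for `sigmaLcmPow`.
[cite: FanKobayashiMolnar2026, Def. 2] -/
def sigmaRpow (κ : ℝ) : ArithmeticFunction ℝ where
  toFun n := if n = 0 then 0 else (σ 1 n : ℝ) ^ κ
  map_zero' := if_pos rfl

/-- `sigmaRpow κ n = σ(n)^κ` for `n ≠ 0`. [cite: FanKobayashiMolnar2026, Def. 2] -/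
theorem sigmaRpow_apply {κ : ℝ} {n : ℕ} (hn : n ≠ 0) : sigmaRpow κ n = (σ 1 n : ℝ) ^ κ :=
  if_neg hn

/-- `n ↦ σ(n)^κ` is multiplicative. [cite: FanKobayashiMolnar2026, §2] -/
theorem isMultiplicative_sigmaRpow (κ : ℝ) : (sigmaRpow κ).IsMultiplicative := by
  refine ⟨by simp [sigmaRpow, ArithmeticFunction.sigma_one_apply], fun {m n} hmn => ?_⟩
  rcases Nat.eq_zero_or_pos m with rfl | hm
  · simp [sigmaRpow]
  rcases Nat.eq_zero_or_pos n with rfl | hn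
  · simp [sigmaRpow]
  rw [sigmaRpow_apply (Nat.mul_ne_zero hm.ne' hn.ne'), sigmaRpow_apply hm.ne',
    sigmaRpow_apply hn.ne',
    ArithmeticFunction.isMultiplicative_sigma.map_mul_of_coprime hmn, Nat.cast_mul,
    Real.mul_rpow (Nat.cast_nonneg _) (Nat.cast_nonneg _)]

/-- **Fan–Kobayashi–Molnar's `κ`-th LCM-power of `σ`** (Definition 2): the Dirichlet convolution
`μ * (σ(·)^κ)`, i.e. `σ^[κ](n) = ∑_{d ∣ n} μ(n/d) σ(d)^κ` (`sigmaLcmPow_apply`). For a positive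
integer `κ = k` this is `∑_{[d₁,…,d_k] = n} d₁ ⋯ d_k` (Definition 1, Lehmer's identity — not proved
here). [cite: FanKobayashiMolnar2026, Def. 2] -/
def sigmaLcmPow (κ : ℝ) : ArithmeticFunction ℝ := (μ : ArithmeticFunction ℝ) * sigmaRpow κ

/-- Definition 2 as printed: `σ^[κ](n) = ∑_{d ∣ n} μ(n/d) σ(d)^κ` (both sides are `0` at
`n = 0`). [cite: FanKobayashiMolnar2026, Def. 2] -/
theorem sigmaLcmPow_apply (κ : ℝ) (n : ℕ) :
    sigmaLcmPow κ n = ∑ d ∈ n.divisors, (μ (n / d) : ℝ) * (σ 1 d : ℝ) ^ κ := by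
  unfold sigmaLcmPow
  rw [ArithmeticFunction.mul_apply,
    Nat.sum_divisorsAntidiagonal' (fun a b => (μ : ArithmeticFunction ℝ) a * sigmaRpow κ b)]
  refine Finset.sum_congr rfl fun d hd => ?_
  rw [ArithmeticFunction.intCoe_apply, sigmaRpow_apply (Nat.pos_of_mem_divisors hd).ne']

/-- `σ^[κ]` is multiplicative (the paper uses this throughout, e.g. proof of Lemma 17).
[cite: FanKobayashiMolnar2026, §3] -/
theorem isMultiplicative_sigmaLcmPow (κ : ℝ) : (sigmaLcmPow κ).IsMultiplicative :=
  ArithmeticFunction.isMultiplicative_moebius.intCast.mul (isMultiplicative_sigmaRpow κ)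

/-- Möbius inversion: `ζ * σ^[κ] = σ(·)^κ`. [cite: FanKobayashiMolnar2026, Def. 2] -/
theorem coe_zeta_mul_sigmaLcmPow (κ : ℝ) :
    (ζ : ArithmeticFunction ℝ) * sigmaLcmPow κ = sigmaRpow κ := by
  rw [sigmaLcmPow, ← mul_assoc, ArithmeticFunction.coe_zeta_mul_coe_moebius, one_mul]

/-- `∑_{d ∣ n} σ^[κ](d) = σ(n)^κ` for `n ≠ 0`. [cite: FanKobayashiMolnar2026, Def. 2] -/
theorem sum_divisors_sigmaLcmPow {κ : ℝ} {n : ℕ} (hn : n ≠ 0) :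
    ∑ d ∈ n.divisors, sigmaLcmPow κ d = (σ 1 n : ℝ) ^ κ := by
  rw [← ArithmeticFunction.coe_zeta_mul_apply, coe_zeta_mul_sigmaLcmPow, sigmaRpow_apply hn]

/-- `∑_{i ≤ a} σ^[κ](p^i) = σ(p^a)^κ`. [cite: FanKobayashiMolnar2026, §3] -/
theorem sum_range_sigmaLcmPow_prime_pow (κ : ℝ) {p : ℕ} (hp : p.Prime) (a : ℕ) :
    ∑ i ∈ Finset.range (a + 1), sigmaLcmPow κ (p ^ i) = (σ 1 (p ^ a) : ℝ) ^ κ := by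
  rw [← sum_divisors_sigmaLcmPow (pow_ne_zero a hp.ne_zero), Nat.divisors_prime_pow hp,
    Finset.sum_map]
  rfl

/-- The prime-power values (paper, §3: `σ^[κ](p^ℓ) = σ(p^ℓ)^κ − σ(p^{ℓ−1})^κ`).
[cite: FanKobayashiMolnar2026, §3] -/
theorem sigmaLcmPow_apply_prime_pow_succ (κ : ℝ) {p : ℕ} (hp : p.Prime) (b : ℕ) :
    sigmaLcmPow κ (p ^ (b + 1)) = (σ 1 (p ^ (b + 1)) : ℝ) ^ κ - (σ 1 (p ^ b) : ℝ) ^ κ := by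
  have h1 := sum_range_sigmaLcmPow_prime_pow κ hp (b + 1)
  rw [Finset.sum_range_succ, sum_range_sigmaLcmPow_prime_pow κ hp b] at h1
  linarith

/-! ### The real number `ζ(κ)` and the partial Euler product bound -/

/-- The real number `ζ(κ) = ∑_{m ≥ 1} m^{−κ}`, `κ > 1` (a `tsum` over `ℕ`, the `m = 0` term being
`0`); `= riemannZeta κ` (`ofReal_zetaRealSum`), `ζ(2) = π²/6` (`zetaRealSum_two`). [folklore] -/
def zetaRealSum (κ : ℝ) : ℝ := ∑' m : ℕ, (m : ℝ) ^ (-κ)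

/-- Summability of `m ↦ m^{−κ}` for `κ > 1` (plumbing). [folklore] -/
private theorem summable_rpow_neg {κ : ℝ} (hκ : 1 < κ) : Summable fun m : ℕ => (m : ℝ) ^ (-κ) :=
  Real.summable_nat_rpow.2 (by linarith)

/-- `zetaRealSum κ` is Mathlib's `riemannZeta κ` for real `κ > 1`: `ζ(s) = ∑ n^{−s}`
(Titchmarsh (1.1.1)). [cite: Titchmarsh1986, (1.1.1)] -/
theorem ofReal_zetaRealSum {κ : ℝ} (hκ : 1 < κ) : (zetaRealSum κ : ℂ) = riemannZeta κ := by
  rw [zeta_eq_tsum_one_div_nat_cpow (by simpa using hκ), zetaRealSum, Complex.ofReal_tsum]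
  refine tsum_congr fun m => ?_
  rw [Complex.ofReal_cpow (Nat.cast_nonneg m), Complex.ofReal_natCast, Complex.ofReal_neg,
    Complex.cpow_neg, one_div]

/-- `ζ(2) = π²/6` for `zetaRealSum` (Euler; Apostol Thm. 12.17 with `k = 1`), so that the paper's
`κ = 2` statements read with `ζ(2) = π²/6`. [cite: Apostol1976, Thm. 12.17 (k = 1)] -/
theorem zetaRealSum_two : zetaRealSum 2 = π ^ 2 / 6 := by
  rw [zetaRealSum, ← hasSum_zeta_two.tsum_eq]
  refine tsum_congr fun m => ?_
  rw [Real.rpow_neg (Nat.cast_nonneg m), one_div]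
  norm_num

/-- `0 < ζ(κ)` for real `κ > 1` (the term `m = 1` of the series `ζ(s) = ∑ n^{−s}`,
Titchmarsh (1.1.1)). [cite: Titchmarsh1986, (1.1.1)] -/
theorem zetaRealSum_pos {κ : ℝ} (hκ : 1 < κ) : 0 < zetaRealSum κ := by
  have h1 : ∑ m ∈ ({1} : Finset ℕ), (m : ℝ) ^ (-κ) ≤ zetaRealSum κ :=
    (summable_rpow_neg hκ).sum_le_tsum _ (fun m _ => by positivity)
  have h2 : ∑ m ∈ ({1} : Finset ℕ), (m : ℝ) ^ (-κ) = 1 := by simp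
  linarith

/-- The completely multiplicative `n ↦ n^{−κ}` as `ℕ →* ℝ` (Euler-product plumbing). [folklore] -/
def rpowNegHom (κ : ℝ) : ℕ →* ℝ where
  toFun n := (n : ℝ) ^ (-κ)
  map_one' := by simp
  map_mul' m n := by
    rw [Nat.cast_mul, Real.mul_rpow (Nat.cast_nonneg _) (Nat.cast_nonneg _)]

/-- **Partial Euler product bound**: `∏_{p ∣ n} (1 − p^{−κ})⁻¹ ≤ ζ(κ)` for real `κ > 1` — the
left side is the sum of `m^{−κ}` over the integers all of whose prime factors divide `n` (Apostol,
proof of Thm. 11.6: `P(x) = ∑_{n ∈ A} f(n)`), a sub-sum of `ζ(κ) = ∏_p (1 − p^{−κ})⁻¹` (Thm. 11.7);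
the paper uses it as `∏_{p ≤ x}(1 − p^{−κ})⁻¹ < ζ(κ)` (§2).
[cite: Apostol1976, Thm. 11.6 (proof) and Thm. 11.7] -/
theorem prod_primeFactors_inv_one_sub_le_zetaRealSum {κ : ℝ} (hκ : 1 < κ) (n : ℕ) :
    ∏ p ∈ n.primeFactors, (1 - (p : ℝ) ^ (-κ))⁻¹ ≤ zetaRealSum κ := by
  have hsum : Summable fun m : ℕ => rpowNegHom κ m := summable_rpow_neg hκ
  have h1 := EulerProduct.prod_filter_prime_geometric_eq_tsum_factoredNumbers hsum n.primeFactors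
  rw [Finset.filter_true_of_mem fun p hp => Nat.prime_of_mem_primeFactors hp] at h1
  simp only [show ∀ m : ℕ, rpowNegHom κ m = (m : ℝ) ^ (-κ) from fun _ => rfl] at h1
  rw [h1]
  exact Summable.tsum_subtype_le (fun m : ℕ => (m : ℝ) ^ (-κ)) (Nat.factoredNumbers n.primeFactors)
    (fun m => by positivity) (summable_rpow_neg hκ)

/-! ### Lemma 17, pointwise: `σ(n)^κ ≤ ζ(κ) σ^[κ](n)` -/

/-- The prime-power step of Lemma 17: for `κ > 0`, `σ(p^a)^κ ≤ (1 − p^{−κ})⁻¹ σ^[κ](p^a)` and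
`0 ≤ σ^[κ](p^a)` (from `σ(p^{a−1}) ≤ σ(p^a)/p`, i.e. `σ(p^a) = p σ(p^{a−1}) + 1`).
[cite: FanKobayashiMolnar2026, Lemma 17 (proof, case a > 0)] -/
theorem sigma_rpow_prime_pow_le {κ : ℝ} (hκ : 0 < κ) {p : ℕ} (hp : p.Prime) (a : ℕ) :
    0 ≤ sigmaLcmPow κ (p ^ a) ∧
      (σ 1 (p ^ a) : ℝ) ^ κ ≤ (1 - (p : ℝ) ^ (-κ))⁻¹ * sigmaLcmPow κ (p ^ a) := by
  have hp1 : (1 : ℝ) < p := by exact_mod_cast hp.one_lt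
  have hp0 : (0 : ℝ) < p := by linarith
  set q : ℝ := (p : ℝ) ^ (-κ) with hq
  have hq0 : 0 < q := Real.rpow_pos_of_pos hp0 _
  have hq1 : q < 1 := Real.rpow_lt_one_of_one_lt_of_neg hp1 (by linarith)
  have h1q : 0 < 1 - q := by linarith
  rcases Nat.eq_zero_or_pos a with rfl | ha
  · have h1 : sigmaLcmPow κ (p ^ 0) = 1 := by
      rw [pow_zero]; exact (isMultiplicative_sigmaLcmPow κ).map_one
    rw [h1, pow_zero]
    refine ⟨zero_le_one, ?_⟩
    have : (σ 1 1 : ℝ) = 1 := by simp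
    rw [this, Real.one_rpow, mul_one]
    exact (one_le_inv₀ h1q).2 (by linarith)
  obtain ⟨b, rfl⟩ := Nat.exists_eq_add_one_of_ne_zero ha.ne'
  -- `S = σ(p^{b+1}) = p T + 1`, `T = σ(p^b)`
  set S : ℝ := (σ 1 (p ^ (b + 1)) : ℝ) with hS
  set T : ℝ := (σ 1 (p ^ b) : ℝ) with hT
  have hST : S = p * T + 1 := by
    rw [hS, hT, RobinCheck.sigma_prime_pow_succ hp b]; push_cast; ring
  have hT0 : 0 ≤ T := by rw [hT]; exact Nat.cast_nonneg _
  have hS0 : 0 ≤ S := by rw [hST]; positivity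
  have hTS : T ≤ S / p := by
    rw [le_div_iff₀ hp0, hST]; linarith
  have hL : sigmaLcmPow κ (p ^ (b + 1)) = S ^ κ - T ^ κ :=
    sigmaLcmPow_apply_prime_pow_succ κ hp b
  -- `T^κ ≤ (S/p)^κ = q S^κ`
  have hTk : T ^ κ ≤ q * S ^ κ := by
    calc T ^ κ ≤ (S / p) ^ κ := Real.rpow_le_rpow hT0 hTS hκ.le
      _ = q * S ^ κ := by
        rw [Real.div_rpow hS0 hp0.le, hq, Real.rpow_neg hp0.le, div_eq_mul_inv, mul_comm]
  have hSk0 : 0 ≤ S ^ κ := Real.rpow_nonneg hS0 _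
  refine ⟨?_, ?_⟩
  · rw [hL]
    have : q * S ^ κ ≤ S ^ κ := by nlinarith
    linarith
  · rw [hL]
    have hmain : (1 - q) * S ^ κ ≤ S ^ κ - T ^ κ := by nlinarith
    calc S ^ κ = (1 - q)⁻¹ * ((1 - q) * S ^ κ) := by
          rw [← mul_assoc, inv_mul_cancel₀ h1q.ne', one_mul]
      _ ≤ (1 - q)⁻¹ * (S ^ κ - T ^ κ) :=
          mul_le_mul_of_nonneg_left hmain (inv_nonneg.2 h1q.le)

/-- `σ^[κ](n) ≥ 0` for `κ > 0`. [cite: FanKobayashiMolnar2026, §3] -/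
theorem sigmaLcmPow_nonneg {κ : ℝ} (hκ : 0 < κ) (n : ℕ) : 0 ≤ sigmaLcmPow κ n := by
  rcases Nat.eq_zero_or_pos n with rfl | hn
  · simp
  rw [(isMultiplicative_sigmaLcmPow κ).multiplicative_factorization _ hn.ne']
  exact Finset.prod_nonneg fun p hp =>
    (sigma_rpow_prime_pow_le hκ (Nat.prime_of_mem_primeFactors (by simpa using hp)) _).1

/-- **Lemma 17, pointwise form** (the consequence `(ζ(κ) σ^[κ](n))^{1/κ} ≥ σ(n)` of the printed
monotonicity in `κ`, raised to the `κ`-th power): for real `κ > 1` and every `n`,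
`σ(n)^κ ≤ ζ(κ) · σ^[κ](n)`. [cite: FanKobayashiMolnar2026, Lemma 17 (and proof of Thm. 5.2)] -/
theorem sigma_rpow_le_zetaRealSum_mul_sigmaLcmPow {κ : ℝ} (hκ : 1 < κ) (n : ℕ) :
    (σ 1 n : ℝ) ^ κ ≤ zetaRealSum κ * sigmaLcmPow κ n := by
  have hκ0 : 0 < κ := by linarith
  rcases Nat.eq_zero_or_pos n with rfl | hn
  · simp [Real.zero_rpow hκ0.ne']
  rw [← sigmaRpow_apply hn.ne',
    (isMultiplicative_sigmaRpow κ).multiplicative_factorization _ hn.ne',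
    (isMultiplicative_sigmaLcmPow κ).multiplicative_factorization _ hn.ne']
  simp only [Finsupp.prod, Nat.support_factorization]
  have hprime : ∀ p ∈ n.primeFactors, p.Prime := fun p hp => Nat.prime_of_mem_primeFactors hp
  calc ∏ p ∈ n.primeFactors, sigmaRpow κ (p ^ n.factorization p)
      ≤ ∏ p ∈ n.primeFactors,
          ((1 - (p : ℝ) ^ (-κ))⁻¹ * sigmaLcmPow κ (p ^ n.factorization p)) := by
        refine Finset.prod_le_prod (fun p hp => ?_) fun p hp => ?_
        · rw [sigmaRpow_apply (pow_ne_zero _ (hprime p hp).ne_zero)]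
          exact Real.rpow_nonneg (Nat.cast_nonneg _) _
        · rw [sigmaRpow_apply (pow_ne_zero _ (hprime p hp).ne_zero)]
          exact (sigma_rpow_prime_pow_le hκ0 (hprime p hp) _).2
    _ = (∏ p ∈ n.primeFactors, (1 - (p : ℝ) ^ (-κ))⁻¹) *
          ∏ p ∈ n.primeFactors, sigmaLcmPow κ (p ^ n.factorization p) := Finset.prod_mul_distrib
    _ ≤ zetaRealSum κ * ∏ p ∈ n.primeFactors, sigmaLcmPow κ (p ^ n.factorization p) :=
        mul_le_mul_of_nonneg_right (prod_primeFactors_inv_one_sub_le_zetaRealSum hκ n)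
          (Finset.prod_nonneg fun p hp => (sigma_rpow_prime_pow_le hκ0 (hprime p hp) _).1)

/-! ### Theorem 5.2 and the `(2) ⇒ RH` half of Theorem 1.3 -/

/-- `1 < log n` for `n > 3` (since `e < 3`; plumbing). [folklore] -/
private theorem one_lt_log_of_three_lt {n : ℕ} (hn : 3 < n) : 1 < log (n : ℝ) := by
  have hn' : (3 : ℝ) < n := by exact_mod_cast hn
  rw [Real.lt_log_iff_exp_lt (by linarith)]
  exact lt_trans (lt_trans Real.exp_one_lt_d9 (by norm_num)) hn'

/-- **Fan–Kobayashi–Molnar 2026, Theorem 5.2** (the `κ`-analogue of Robin's theorem; from the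
tree's PROVED Robin 1984 §4 Prop. 1 `Robin1984_sigma_oscillation_holds` and Lemma 17): if the
Riemann hypothesis fails, there are `b ∈ (0, 1/2)` and `c > 0`, independent of `κ`, such that for
every real `κ > 1` the inequality
`σ^[κ](n) > (e^γ n log log n)^κ ζ(κ)⁻¹ (1 + c/(log n)^b)^κ` holds for infinitely many `n`.
(Printed with `b` ranging over `(1 − B, 1/2)`, `B = sup Re ρ`; the tree's fact gives some `b`.)
[cite: FanKobayashiMolnar2026, Thm. 5.2] -/
theorem FanKobayashiMolnar2026_thm52 (hRH : ¬ RiemannHypothesis) :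
    ∃ b c : ℝ, 0 < b ∧ b < 1 / 2 ∧ 0 < c ∧ ∀ κ : ℝ, 1 < κ →
      ∃ᶠ n : ℕ in atTop,
        (exp eulerMascheroniConstant * n * log (log n)) ^ κ / zetaRealSum κ *
            (1 + c / log n ^ b) ^ κ < sigmaLcmPow κ n := by
  obtain ⟨β, C, hβ0, hβ, hC, hfreq⟩ := Robin1984_sigma_oscillation_holds hRH
  refine ⟨β, C * exp (-eulerMascheroniConstant) / 2, hβ0, hβ, by positivity, fun κ hκ => ?_⟩
  have hκ0 : 0 < κ := by linarith
  have hZ := zetaRealSum_pos hκ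
  refine (hfreq.and_eventually (eventually_gt_atTop 3)).mono fun n ⟨hn, hn3⟩ => ?_
  have hlog1 : 1 < log (n : ℝ) := one_lt_log_of_three_lt hn3
  have hL : 0 < log (log (n : ℝ)) := Real.log_pos hlog1
  have hX : 0 < log (n : ℝ) ^ β := Real.rpow_pos_of_pos (by linarith) _
  set X : ℝ := log (n : ℝ) ^ β with hXdef
  set R : ℝ := exp eulerMascheroniConstant * n * log (log n) with hR
  have hR0 : 0 < R := by positivity
  set c : ℝ := C * exp (-eulerMascheroniConstant) / 2 with hc
  have hc0 : 0 < c := by positivity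
  have hRc : R * (2 * c) = C * n * log (log n) := by
    have hee : exp eulerMascheroniConstant * exp (-eulerMascheroniConstant) = 1 := by
      rw [← Real.exp_add, add_neg_cancel, Real.exp_zero]
    calc R * (2 * c)
        = C * n * log (log n) * (exp eulerMascheroniConstant * exp (-eulerMascheroniConstant)) := by
          rw [hR, hc]; ring
      _ = C * n * log (log n) := by rw [hee, mul_one]
  have hσ : R * (1 + 2 * c / X) ≤ (σ 1 n : ℝ) := by
    rw [mul_add, mul_one, ← mul_div_assoc, hRc]; exact hn
  have h1 : (R * (1 + 2 * c / X)) ^ κ ≤ (σ 1 n : ℝ) ^ κ :=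
    Real.rpow_le_rpow (by positivity) hσ hκ0.le
  have h2 : (R * (1 + c / X)) ^ κ < (R * (1 + 2 * c / X)) ^ κ := by
    refine Real.rpow_lt_rpow (by positivity) ?_ hκ0
    have : c / X < 2 * c / X := div_lt_div_of_pos_right (by linarith) hX
    nlinarith
  have h4 : R ^ κ * (1 + c / X) ^ κ < zetaRealSum κ * sigmaLcmPow κ n := by
    rw [← Real.mul_rpow hR0.le (by positivity)]
    exact lt_of_lt_of_le h2 (h1.trans (sigma_rpow_le_zetaRealSum_mul_sigmaLcmPow hκ n))
  rw [div_mul_eq_mul_div, div_lt_iff₀ hZ]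
  exact lt_of_lt_of_eq h4 (mul_comm _ _)

/-- **Fan–Kobayashi–Molnar 2026, Theorem 1.3, (2) ⇒ (1)** (and Theorem 7.2's analogous half), for
every real `κ > 1`: if `σ^[κ](n) < (e^γ n log log n)^κ / ζ(κ)` for all sufficiently large `n`, then
the Riemann hypothesis holds. (Printed for `κ > 3/2`, where the converse also holds; this direction
is Theorem 5.2 and needs only `κ > 1`.) [cite: FanKobayashiMolnar2026, Thm. 1.3] -/
theorem FanKobayashiMolnar2026_thm13_rh_of_eventually {κ : ℝ} (hκ : 1 < κ)
    (h : ∀ᶠ n : ℕ in atTop,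
      sigmaLcmPow κ n < (exp eulerMascheroniConstant * n * log (log n)) ^ κ / zetaRealSum κ) :
    RiemannHypothesis := by
  by_contra hRH
  obtain ⟨b, c, -, -, hc, hall⟩ := FanKobayashiMolnar2026_thm52 hRH
  have hκ0 : 0 < κ := by linarith
  have hZ := zetaRealSum_pos hκ
  obtain ⟨n, ⟨hn1, hn2⟩, hn3⟩ :=
    (((hall κ hκ).and_eventually h).and_eventually (eventually_gt_atTop 3)).exists
  have hlog1 : 1 < log (n : ℝ) := one_lt_log_of_three_lt hn3
  have hL : 0 < log (log (n : ℝ)) := Real.log_pos hlog1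
  have hX : 0 < log (n : ℝ) ^ b := Real.rpow_pos_of_pos (by linarith) _
  have hW : 1 ≤ (1 + c / log (n : ℝ) ^ b) ^ κ :=
    Real.one_le_rpow (by have := div_pos hc hX; linarith) hκ0.le
  have hRZ : 0 ≤ (exp eulerMascheroniConstant * n * log (log n)) ^ κ / zetaRealSum κ :=
    div_nonneg (Real.rpow_nonneg (by positivity) _) hZ.le
  have := le_mul_of_one_le_right hRZ hW
  linarith

/-- Theorem 1.3, (2′) ⇒ (1), threshold form: if for some `n₀` (the paper: `n₀ = 2162160`, `κ ≥ 2`)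
`σ^[κ](n) < (e^γ n log log n)^κ / ζ(κ)` for every `n > n₀`, then RH (`κ > 1` real).
[cite: FanKobayashiMolnar2026, Thm. 1.3 (2′)] -/
theorem FanKobayashiMolnar2026_thm13_rh_of_forall_gt {κ : ℝ} (hκ : 1 < κ) (n₀ : ℕ)
    (h : ∀ n : ℕ, n₀ < n →
      sigmaLcmPow κ n < (exp eulerMascheroniConstant * n * log (log n)) ^ κ / zetaRealSum κ) :
    RiemannHypothesis :=
  FanKobayashiMolnar2026_thm13_rh_of_eventually hκ ((eventually_gt_atTop n₀).mono h)

/-- **"Counterexamples accrue as `κ` shrinks"** (the content of Lemma 17 for the criterion): at any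
`n` with `log log n ≥ 0`, the `κ`-Robin inequality `σ^[κ](n) < (e^γ n log log n)^κ/ζ(κ)` implies
Robin's inequality `σ(n) < e^γ n log log n`; equivalently a violation of Robin's inequality at `n`
is a violation of every `κ`-Robin inequality at `n` (`κ > 1`).
[cite: FanKobayashiMolnar2026, Lemma 17 / Remark 1] -/
theorem robinInequality_of_sigmaLcmPow_lt {κ : ℝ} (hκ : 1 < κ) {n : ℕ}
    (hn : 0 ≤ log (log (n : ℝ)))
    (h : sigmaLcmPow κ n < (exp eulerMascheroniConstant * n * log (log n)) ^ κ / zetaRealSum κ) :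
    robinInequality n := by
  have hκ0 : 0 < κ := by linarith
  have hZ := zetaRealSum_pos hκ
  have hR : 0 ≤ exp eulerMascheroniConstant * n * log (log (n : ℝ)) := by positivity
  have h1 := sigma_rpow_le_zetaRealSum_mul_sigmaLcmPow hκ n
  rw [lt_div_iff₀ hZ] at h
  have h2 : (σ 1 n : ℝ) ^ κ < (exp eulerMascheroniConstant * n * log (log n)) ^ κ := by
    nlinarith [mul_comm (zetaRealSum κ) (sigmaLcmPow κ n)]
  unfold robinInequality
  exact (Real.rpow_lt_rpow_iff (Nat.cast_nonneg _) hR hκ0).1 h2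

end Literature.NumberTheory.LFunctions
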